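import Summits.HodgeConjecture.HodgeConjecture.Theorems.F0P3cStCharTSAdRegularisedDetTwo            -- ★ p852348 (this seat) C7 at `N = 2` + `addEquivAddHaarChar_eq_sqrt_normAbs_fin_two` (the `hDval` value at `N = 2`)
import Summits.HodgeConjecture.HodgeConjecture.Theorems.F0P3cStCharTSJacCartanElliptic              -- ★ p852303 (LH5-p02) C8b-model HEAD `tubeJacobianLocal_elliptic_model` (generic `N`)
import Summits.HodgeConjecture.HodgeConjecture.Theorems.F0P3cStCharTSTubeJacobianTransportNonsplit  -- ★ p852024 (A-p12) Q9 generic `tubeJacobianLocal_local_of_forall_model`, `localNonsplitEquiv_mem_iff`, `isRegularElt_localNonsplitEquiv_iff`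
import Summits.HodgeConjecture.HodgeConjecture.Theorems.F0P3cStCharTSHCDModel                       -- ★ p852237 (LH6-p03): brings ★ `model_pins` (σ_w involutive ∕ continuous), ★ (MP) `exists_units_galAdicCompletionMap_eq_neg`, `secondCountableTopology_localField`
import Summits.HodgeConjecture.HodgeConjecture.Theorems.F0P3cStCharTSDGLc                           -- ★ (F0P3-p02) `dgFormulaTwo_eventually_eq` (the `N = 2` closed form is locally constant at unit discriminant)
import Literature.LinearAlgebra.Matrix.CharpolyDiscTwinBridge                                      -- ★ `isUnit_discr_iff_separable_of_monic` (unit discriminant ↔ separable, monic over a commutative ring)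
import Literature.NumberTheory.Rogawski1990.LocalNormFibreSurjectiveNonsplit                        -- ★ `charpoly_localNonsplitEquiv` (generic `N`, `H`)
import Literature.NumberTheory.Automorphic.SelfDualLatticeCountFrameTransportCM                      -- ★ `placeForm_antidiagTwo_hermitian`, `det_placeForm_antidiagTwo` (the model form `J_w = !![0,1;1,0]`)
import HarnessLib

/-!
# F0 · P3c · line LH6 «StCharTS» — ROAD «UP-TR» brick (H4c)(i) «N = 2 DOCK»: the local tube-Jacobian socket at every COMPACT Cartan subgroup `T = Z(γ₀)` of the rank-one
# factor `U(Φ₂)(L⁺_v)` of `H_v = U(Φ₂) × U(Φ₁)` (`v` non-split), weight `D = D_H²` in RUNG0's `eDH` closed form — the ★ WEIGHT-DOCK file 2 ∕ 2 pattern ONE RANK DOWN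

Cell `pub/hodgecm-mathlib`, crux H413 = `stmt-HodgeConjecture-24833` (lane `--supports … --as helper`), route HCCMUnconditional; seat LH6-p04 (g7); ROAD «UP-TR» (holder F0P3-p02 (g23),
CENSUS-UPTR v1 §3 (H4)) brick (H4c)(i) per the JAC-ELL lineage's ROUTE (LH5-p02 (g7), F0∕P3 bus 2026-09-02T18:20:33Z: «(i) N = 2 DOCK → LH6-p04»; (ii) PRODUCT SEAM → LH5-p02;
(iii) H-TERMINUS → LH10-p02).  THEOREMS ONLY (no definition ∕ instance ∕ notation ∕ named fact ∕ `sorry`); ★-only imports.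

WHAT.  ★ C8b-model `tubeJacobianLocal_elliptic_model` is generic in `N`; ★ Q9 `tubeJacobianLocal_local_of_forall_model` is generic in `(N, J)`; ★ p852348 supplies `hDval` at `N = 2`
(`χ(L) = √‖−disc(χ_{t₀}) ∕ det(t₀)‖_{L_w}`); ★ DGLc `dgFormulaTwo_eventually_eq` supplies `hDlc`.  THIS FILE assembles them on `G₂ = U(Φ₂)(L⁺_v) = (cmDatum L 2 Φ₂).Local v`
(`Φ₂` the antidiagonal unit form, the organ's `HLoc` first factor token for token): `T' := Z(e γ₀) = e '' T`, `Φ' := e ∘ Φ ∘ (e⁻¹ × e⁻¹)`, `D' := D ∘ e⁻¹`, Borel structures and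
transported instances, `J_w = !![0, 1; 1, 0]` hermitian with unit determinant (★ `placeForm_antidiagTwo_hermitian`, ★ `det_placeForm_antidiagTwo`), and the `N = 2` weight dictionary `∏_{w′} |disc χ_g|_{w′} · (∏_{w′} |det g|_{w′})⁻¹ =
‖−disc(χ_{e g}) ∕ det(e g)‖_{L_w}` (§1, one place over `v`).  HEAD `tubeJacobianLocal_cartan_U2_elliptic`: for `T = Z(γ₀) ≤ G₂` COMPACT with `γ₀` regular, ANY Haar `ν` and
left-invariant `tm` (socket classes), the conjugation family `Φ`, and `D t = √(∏_{w′}|disc χ_t|_{w′} · (∏_{w′}|det t|_{w′})⁻¹)` (eDH's radicand, so `(𝔇.DH (t, u))² = D t`): the (E1b)-shape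
socket `∀ t₀ regular, ∃ U A₀, … ν(Φ(A₀ × V)) = μ₀(A₀) · ∫⁻_V D dtm` — Q9's conclusion on `«local» L c̄ 2 Φ₂ v` token for token, the input of the (H4c)(ii) product seam.
HONEST LABEL: count-neutral plumbing toward `hUpTr` [Rogawski1990 §12.5 p. 183] via WIF-H; closes no organ; HC_CM is proved only modulo the 7 printed citations (2 remaining:
hLiu418 = `stmt-HodgeConjecture-24832`, h413 = `stmt-HodgeConjecture-24833`) until rung 0 closes.

## References
* [HarishChandra1970] Harish-Chandra (notes by G. van Dijk), *Harmonic analysis on reductive p-adic groups*, LNM 162 (1970), Part V §4 Lemma 22.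
* [Rogawski1990] J. D. Rogawski, *Automorphic Representations of Unitary Groups in Three Variables*, Ann. of Math. Stud. 123 (1990), §12.5 pp. 182–183, §4.9 p. 54 (`D_H`).
* [PlatonovRapinchuk1994] V. Platonov, A. Rapinchuk, *Algebraic Groups and Number Theory* (1994), §5.1 (the one-place model).
-/

set_option autoImplicit false
-- the mandated namespace has the single-problem summit's repeated segment (`HodgeConjecture.HodgeConjecture`)
set_option linter.dupNamespace false

noncomputable section

open MeasureTheory Measure Set Filter Topology Function NumberField IsDedekindDomain Polynomial
open Literature.MeasureTheory.Group
open Literature.NumberTheory.Automorphic Literature.NumberTheory.Automorphic.UnitaryGroup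
open Literature.NumberTheory.GaloisRepresentations.IsNonarchimedeanLocalField (normAbs)
open Literature.NumberTheory.Rogawski1990 (IsRegularElt isRegularElt_iff)
open Summit.HodgeConjecture.HodgeConjecture.Cruxes.H413.F0P3cStCharTSTubeJacobianTransportNonsplit
open Summit.HodgeConjecture.HodgeConjecture.Cruxes.H413.F0P3cStCharTSJacCartanElliptic
open scoped ENNReal NNReal Matrix MatrixGroups Pointwise

namespace Summit.HodgeConjecture.HodgeConjecture.Cruxes.H413.F0P3cStCharTSJacCartanWeightDockTwo

/-! ## §1 The rank-one weight dictionary -/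

/-- `disc` commutes with a ring map in degree `2` (Mathlib's explicit quadratic formula on both sides). [folklore] -/
theorem discr_map_ringHom_of_degree_eq_two {R S : Type*} [CommRing R] [CommRing S] (f : R →+* S) (p : R[X]) (hp : p.degree = 2)
    (hp' : (p.map f).degree = 2) : (p.map f).discr = f p.discr := by
  rw [Polynomial.discr_of_degree_eq_two hp, Polynomial.discr_of_degree_eq_two hp']
  simp only [Polynomial.coeff_map, map_sub, map_mul, map_pow, map_ofNat]

section CM

variable (L : Type) [Field L] [NumberField L] [IsCMField L] (v : HeightOneSpectrum (𝓞 ↥(maximalRealSubfield L)))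
  (w : PlacesOver L v) (hw : IsCMField.complexConj L • w.1 = w.1)

include hw in
/-- **THE RANK-ONE WEIGHT DICTIONARY.**  At a non-split `v` (one place `w ∣ v`, ★ `PlacesOver.subsingleton_of_smul_eq`), for `g ∈ U(Φ₃)(L⁺_v)` with model image `e g ∈ U(σ_w, Φ₃)(L_w)`
(`e = localNonsplitEquiv`, matrix `= (matrix of g).map ev_w`): `∏_{w′} |disc(χ_g)_{w′}|_{w′} · (∏_{w′} |det(g)_{w′}|_{w′})⁻² = ‖−disc(χ_{e g}) ∕ det(e g)²‖_{L_w}` in `ℝ≥0`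
(RUNG0's `eDG` radicand = the radicand of file 1 ∕ 2's `addEquivAddHaarChar_eq_sqrt_normAbs`). [cite: Rogawski1990, §4.9 p. 54] [cite: PlatonovRapinchuk1994, §5.1] -/
theorem weightFormula_eq_normAbs_model_two (g : (UnitaryGroup.cmDatum L 2 (Matrix.of fun i j : Fin 2 => if i.val + j.val + 1 = 2 then (1 : L) else 0)).Local v) :
    (∏ w' : PlacesOver L v, normAbs (w'.1.adicCompletion L) (((g.val : GL (Fin 2) (UnitaryGroup.LocalRing L v)).val.charpoly.discr) w')) *
        (∏ w' : PlacesOver L v, normAbs (w'.1.adicCompletion L) (((g.val : GL (Fin 2) (UnitaryGroup.LocalRing L v)).val.det) w'))⁻¹ =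
      normAbs (w.1.adicCompletion L)
        (-(((localNonsplitEquiv (IsCMField.complexConj L) (Matrix.of fun i j : Fin 2 => if i.val + j.val + 1 = 2 then (1 : L) else 0) (IsCMField.complexConj_ne_one L) w hw g :
              ↥(unitaryGroupOfForm (galAdicCompletionMap (L := L) (IsCMField.complexConj L) hw) (placeForm (Matrix.of fun i j : Fin 2 => if i.val + j.val + 1 = 2 then (1 : L) else 0) w.1))) :
              GL (Fin 2) (w.1.adicCompletion L)) : Matrix (Fin 2) (Fin 2) (w.1.adicCompletion L)).charpoly.discr /
          (((localNonsplitEquiv (IsCMField.complexConj L) (Matrix.of fun i j : Fin 2 => if i.val + j.val + 1 = 2 then (1 : L) else 0) (IsCMField.complexConj_ne_one L) w hw g :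
              ↥(unitaryGroupOfForm (galAdicCompletionMap (L := L) (IsCMField.complexConj L) hw) (placeForm (Matrix.of fun i j : Fin 2 => if i.val + j.val + 1 = 2 then (1 : L) else 0) w.1))) :
              GL (Fin 2) (w.1.adicCompletion L)) : Matrix (Fin 2) (Fin 2) (w.1.adicCompletion L)).det) := by
  haveI : Subsingleton (PlacesOver L v) := PlacesOver.subsingleton_of_smul_eq (IsCMField.complexConj L) (IsCMField.complexConj_ne_one L) w hw
  set ev := Pi.evalRingHom (fun w' : PlacesOver L v => w'.1.adicCompletion L) w with hev
  haveI : Nontrivial (UnitaryGroup.LocalRing L v) := ev.domain_nontrivial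
  -- the model matrix is the `w`-component
  have hmat : (((localNonsplitEquiv (IsCMField.complexConj L) (Matrix.of fun i j : Fin 2 => if i.val + j.val + 1 = 2 then (1 : L) else 0) (IsCMField.complexConj_ne_one L) w hw g :
        ↥(unitaryGroupOfForm (galAdicCompletionMap (L := L) (IsCMField.complexConj L) hw) (placeForm (Matrix.of fun i j : Fin 2 => if i.val + j.val + 1 = 2 then (1 : L) else 0) w.1))) :
        GL (Fin 2) (w.1.adicCompletion L)) : Matrix (Fin 2) (Fin 2) (w.1.adicCompletion L)) =
      ((g.val : GL (Fin 2) (UnitaryGroup.LocalRing L v)).val : Matrix (Fin 2) (Fin 2) (UnitaryGroup.LocalRing L v)).map ev := rfl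
  have hchar := Literature.NumberTheory.Rogawski1990.charpoly_localNonsplitEquiv (L := L) (w := w) (hw := hw) (g := g)
  have hdeg : ((g.val : GL (Fin 2) (UnitaryGroup.LocalRing L v)).val : Matrix (Fin 2) (Fin 2) (UnitaryGroup.LocalRing L v)).charpoly.degree = 2 := by
    rw [Matrix.charpoly_degree_eq_dim]; rfl
  have hdeg' : (((g.val : GL (Fin 2) (UnitaryGroup.LocalRing L v)).val : Matrix (Fin 2) (Fin 2) (UnitaryGroup.LocalRing L v)).charpoly.map ev).degree = 2 := by
    rw [← Matrix.charpoly_map, Matrix.charpoly_degree_eq_dim]; rfl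
  have hdisc : (((localNonsplitEquiv (IsCMField.complexConj L) (Matrix.of fun i j : Fin 2 => if i.val + j.val + 1 = 2 then (1 : L) else 0) (IsCMField.complexConj_ne_one L) w hw g :
        ↥(unitaryGroupOfForm (galAdicCompletionMap (L := L) (IsCMField.complexConj L) hw) (placeForm (Matrix.of fun i j : Fin 2 => if i.val + j.val + 1 = 2 then (1 : L) else 0) w.1))) :
        GL (Fin 2) (w.1.adicCompletion L)) : Matrix (Fin 2) (Fin 2) (w.1.adicCompletion L)).charpoly.discr =
      ((g.val : GL (Fin 2) (UnitaryGroup.LocalRing L v)).val.charpoly.discr) w := by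
    rw [hchar, discr_map_ringHom_of_degree_eq_two ev _ hdeg hdeg', hev, Pi.evalRingHom_apply]
  have hdet : (((localNonsplitEquiv (IsCMField.complexConj L) (Matrix.of fun i j : Fin 2 => if i.val + j.val + 1 = 2 then (1 : L) else 0) (IsCMField.complexConj_ne_one L) w hw g :
        ↥(unitaryGroupOfForm (galAdicCompletionMap (L := L) (IsCMField.complexConj L) hw) (placeForm (Matrix.of fun i j : Fin 2 => if i.val + j.val + 1 = 2 then (1 : L) else 0) w.1))) :
        GL (Fin 2) (w.1.adicCompletion L)) : Matrix (Fin 2) (Fin 2) (w.1.adicCompletion L)).det =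
      ((g.val : GL (Fin 2) (UnitaryGroup.LocalRing L v)).val.det) w := by
    rw [hmat, ← RingHom.mapMatrix_apply, ← RingHom.map_det, hev, Pi.evalRingHom_apply]
  have hneg1 : normAbs (w.1.adicCompletion L) (-1) = 1 := by
    have h := map_mul (normAbs (w.1.adicCompletion L)) (-1) (-1)
    rw [neg_one_mul, neg_neg, map_one] at h
    have h' : normAbs (w.1.adicCompletion L) (-1) ^ 2 = 1 := by rw [pow_two]; exact h.symm
    exact (pow_eq_one_iff.1 h').resolve_right two_ne_zero
  rw [Fintype.prod_subsingleton _ w, Fintype.prod_subsingleton _ w, hdisc, hdet, neg_div, ← neg_one_mul, map_mul, hneg1, one_mul, map_div₀, div_eq_mul_inv]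

/-! ## §2 THE `N = 2` DOCK: the local tube-Jacobian socket at a COMPACT Cartan subgroup of `U(Φ₂)(L⁺_v)`, weight `D = D_H²` in RUNG0's `eDH` closed form -/

set_option maxHeartbeats 1600000 in
-- the model instantiation elaborates the long socket binders of ★ Q9-CM and ★ C8b-model at `K = L_w`
include hw in
/-- **(H4c)(i) «N = 2 DOCK» — the local tube-Jacobian socket on `G₂ = U(Φ₂)(L⁺_v)` at a COMPACT Cartan subgroup `T = Z(γ₀)`** (`γ₀` regular, `v` non-split with `w ∣ v` fixed by
`c̄`): for any Haar `ν` (right-invariant class), any left-invariant `tm` on `T` (finite on compacts, positive on opens, inversion-invariant), the conjugation family `Φ`, and the weight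
`D t = √(∏_{w′∣v} |disc χ_t|_{w′} · (∏_{w′} |det t|_{w′})⁻¹)` (eDH's radicand), EVERY regular `t₀ ∈ T` has an open `U ∋ t₀` and a Borel transversal class `A₀` of positive finite quotient mass
with `ν(Φ(A₀ × V)) = μ₀(A₀) · ∫⁻_V D dtm` for all Borel `W`-free regular `V ⊆ U` — ★ Q9 generic fed with ★ C8b-model at `N = 2`, every model-side input constructed ∕ discharged here,
`hDlc` by ★ DGLc `dgFormulaTwo_eventually_eq`, `hDval` by ★ p852348 `addEquivAddHaarChar_eq_sqrt_normAbs_fin_two` + §1. [cite: HarishChandra1970, Lemma 22]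
[cite: Rogawski1990, §12.5 pp. 182–183; §4.9 p. 54] [cite: PlatonovRapinchuk1994, §5.1] -/
theorem tubeJacobianLocal_cartan_U2_elliptic
    {T : Subgroup ((UnitaryGroup.cmDatum L 2 (Matrix.of fun i j : Fin 2 => if i.val + j.val + 1 = 2 then (1 : L) else 0)).Local v)} {γ₀ : (UnitaryGroup.cmDatum L 2 (Matrix.of fun i j : Fin 2 => if i.val + j.val + 1 = 2 then (1 : L) else 0)).Local v}
    (hT : T = Subgroup.centralizer ({γ₀} : Set ((UnitaryGroup.cmDatum L 2 (Matrix.of fun i j : Fin 2 => if i.val + j.val + 1 = 2 then (1 : L) else 0)).Local v)))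
    (hγ₀ : IsRegularElt (γ₀.val : GL (Fin 2) (UnitaryGroup.LocalRing L v)))
    (hTcpt : IsCompact (T : Set ((UnitaryGroup.cmDatum L 2 (Matrix.of fun i j : Fin 2 => if i.val + j.val + 1 = 2 then (1 : L) else 0)).Local v)))
    (Φ : ((UnitaryGroup.cmDatum L 2 (Matrix.of fun i j : Fin 2 => if i.val + j.val + 1 = 2 then (1 : L) else 0)).Local v ⧸ T) × ↥T → (UnitaryGroup.cmDatum L 2 (Matrix.of fun i j : Fin 2 => if i.val + j.val + 1 = 2 then (1 : L) else 0)).Local v) (hΦ : ∀ (x : (UnitaryGroup.cmDatum L 2 (Matrix.of fun i j : Fin 2 => if i.val + j.val + 1 = 2 then (1 : L) else 0)).Local v) (t : ↥T), Φ (QuotientGroup.mk x, t) = x * t * x⁻¹)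
    [instM : MeasurableSpace ((UnitaryGroup.cmDatum L 2 (Matrix.of fun i j : Fin 2 => if i.val + j.val + 1 = 2 then (1 : L) else 0)).Local v)] [instB : BorelSpace ((UnitaryGroup.cmDatum L 2 (Matrix.of fun i j : Fin 2 => if i.val + j.val + 1 = 2 then (1 : L) else 0)).Local v)] [instLC : LocallyCompactSpace ((UnitaryGroup.cmDatum L 2 (Matrix.of fun i j : Fin 2 => if i.val + j.val + 1 = 2 then (1 : L) else 0)).Local v)]
    [instSC : SecondCountableTopology ((UnitaryGroup.cmDatum L 2 (Matrix.of fun i j : Fin 2 => if i.val + j.val + 1 = 2 then (1 : L) else 0)).Local v)] [instT2 : T2Space ((UnitaryGroup.cmDatum L 2 (Matrix.of fun i j : Fin 2 => if i.val + j.val + 1 = 2 then (1 : L) else 0)).Local v)] (hTc : IsClosed (T : Set ((UnitaryGroup.cmDatum L 2 (Matrix.of fun i j : Fin 2 => if i.val + j.val + 1 = 2 then (1 : L) else 0)).Local v)))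
    [instQM : MeasurableSpace ((UnitaryGroup.cmDatum L 2 (Matrix.of fun i j : Fin 2 => if i.val + j.val + 1 = 2 then (1 : L) else 0)).Local v ⧸ T)] [instQB : BorelSpace ((UnitaryGroup.cmDatum L 2 (Matrix.of fun i j : Fin 2 => if i.val + j.val + 1 = 2 then (1 : L) else 0)).Local v ⧸ T)]
    (ν : Measure ((UnitaryGroup.cmDatum L 2 (Matrix.of fun i j : Fin 2 => if i.val + j.val + 1 = 2 then (1 : L) else 0)).Local v)) [instν₁ : ν.IsHaarMeasure] [instν₂ : ν.IsMulRightInvariant]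
    (tm : Measure ↥T) [instt₁ : tm.IsMulLeftInvariant] [instt₂ : IsFiniteMeasureOnCompacts tm] [instt₃ : tm.IsOpenPosMeasure] [instt₄ : tm.IsInvInvariant]
    (D : ↥T → ℝ≥0)
    (hD : ∀ t : ↥T, D t = NNReal.sqrt
      ((∏ w' : PlacesOver L v, normAbs (w'.1.adicCompletion L) ((((t : (UnitaryGroup.cmDatum L 2 (Matrix.of fun i j : Fin 2 => if i.val + j.val + 1 = 2 then (1 : L) else 0)).Local v).val : GL (Fin 2) (UnitaryGroup.LocalRing L v)).val.charpoly.discr) w')) *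
        (∏ w' : PlacesOver L v, normAbs (w'.1.adicCompletion L) ((((t : (UnitaryGroup.cmDatum L 2 (Matrix.of fun i j : Fin 2 => if i.val + j.val + 1 = 2 then (1 : L) else 0)).Local v).val : GL (Fin 2) (UnitaryGroup.LocalRing L v)).val.det) w'))⁻¹)) :
    ∀ t₀ : ↥T, IsRegularElt (((t₀ : (UnitaryGroup.cmDatum L 2 (Matrix.of fun i j : Fin 2 => if i.val + j.val + 1 = 2 then (1 : L) else 0)).Local v)).val : GL (Fin 2) (UnitaryGroup.LocalRing L v)) →
      ∃ U : Set ↥T, IsOpen U ∧ t₀ ∈ U ∧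
        ∃ A₀ : Set ((UnitaryGroup.cmDatum L 2 (Matrix.of fun i j : Fin 2 => if i.val + j.val + 1 = 2 then (1 : L) else 0)).Local v ⧸ T), MeasurableSet A₀ ∧ (quotientMeasure T tm hTc ν) A₀ ≠ 0 ∧
          (quotientMeasure T tm hTc ν) A₀ ≠ ∞ ∧
          ∀ V : Set ↥T, MeasurableSet V → V ⊆ U → (∀ t ∈ V, IsRegularElt (((t : (UnitaryGroup.cmDatum L 2 (Matrix.of fun i j : Fin 2 => if i.val + j.val + 1 = 2 then (1 : L) else 0)).Local v)).val : GL (Fin 2) (UnitaryGroup.LocalRing L v))) →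
            (∀ n : (UnitaryGroup.cmDatum L 2 (Matrix.of fun i j : Fin 2 => if i.val + j.val + 1 = 2 then (1 : L) else 0)).Local v, n ∉ T → ∀ t ∈ V, ∀ t' ∈ V, ((t' : ↥T) : (UnitaryGroup.cmDatum L 2 (Matrix.of fun i j : Fin 2 => if i.val + j.val + 1 = 2 then (1 : L) else 0)).Local v) ≠ n * t * n⁻¹) →
              ν (Φ '' (A₀ ×ˢ V)) = (quotientMeasure T tm hTc ν) A₀ * ∫⁻ t in V, (D t : ℝ≥0∞) ∂tm := by
  classical
  -- ### the one-place model
  set K := w.1.adicCompletion L with hK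
  set σ := galAdicCompletionMap (L := L) (IsCMField.complexConj L) hw with hσdef
  set J := placeForm (Matrix.of fun i j : Fin 2 => if i.val + j.val + 1 = 2 then (1 : L) else 0) w.1 with hJdef
  set e := localNonsplitEquiv (IsCMField.complexConj L) (Matrix.of fun i j : Fin 2 => if i.val + j.val + 1 = 2 then (1 : L) else 0) (IsCMField.complexConj_ne_one L) w hw with hedef
  obtain ⟨hσ2, -, hσc, -⟩ := F0P3cStCharTSTubeModelTransport.model_pins L v w hw
  have hJ : IsUnit J.det := by rw [hJdef, det_placeForm_antidiagTwo L v w]; exact isUnit_one.neg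
  have hJh : (J.map σ)ᵀ = J := placeForm_antidiagTwo_hermitian L v w hw
  haveI : CharZero K := charZero_of_injective_algebraMap (algebraMap L K).injective
  haveI : SecondCountableTopology K := secondCountableTopology_localField K
  have hσne : ∃ a : K, σ a ≠ a := by
    obtain ⟨lam, hlam⟩ := exists_units_galAdicCompletionMap_eq_neg (IsCMField.complexConj L) (IsCMField.complexConj_ne_one L) v w hw
    refine ⟨(lam : K), fun h => lam.ne_zero ?_⟩
    have h2 : (2 : K) * (lam : K) = 0 := by rw [two_mul]; nth_rw 1 [← h]; rw [hlam, neg_add_cancel]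
    exact (mul_eq_zero.1 h2).resolve_left two_ne_zero
  -- ### the model Cartan `T' = Z(e γ₀)`
  set γ₀' := e γ₀ with hγ₀'def
  have hγ₀' : IsRegularElt ((γ₀' : ↥(unitaryGroupOfForm σ J)) : GL (Fin 2) K) :=
    (isRegularElt_localNonsplitEquiv_iff (IsCMField.complexConj L) 2 (Matrix.of fun i j : Fin 2 => if i.val + j.val + 1 = 2 then (1 : L) else 0) (IsCMField.complexConj_ne_one L) w hw γ₀).2 hγ₀
  set T' : Subgroup ↥(unitaryGroupOfForm σ J) := Subgroup.centralizer ({γ₀'} : Set ↥(unitaryGroupOfForm σ J)) with hT'def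
  have hT' : ∀ g', g' ∈ T' ↔ g' * e γ₀ = e γ₀ * g' := fun g' => by
    rw [hT'def, Subgroup.mem_centralizer_iff]
    exact ⟨fun h => (h γ₀' (Set.mem_singleton _)).symm, fun h x hx => by rw [Set.mem_singleton_iff.1 hx]; exact h.symm⟩
  have hTT' : ∀ g : (UnitaryGroup.cmDatum L 2 (Matrix.of fun i j : Fin 2 => if i.val + j.val + 1 = 2 then (1 : L) else 0)).Local v, e.toMulEquiv g ∈ T' ↔ g ∈ T :=
    localNonsplitEquiv_mem_iff (IsCMField.complexConj L) 2 (Matrix.of fun i j : Fin 2 => if i.val + j.val + 1 = 2 then (1 : L) else 0) (IsCMField.complexConj_ne_one L) w hw hT hT'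
  -- `e⁻¹` read with values in the `cmDatum`-typed carrier `G₂`, and its algebra
  let es : ↥(unitaryGroupOfForm σ J) → (UnitaryGroup.cmDatum L 2 (Matrix.of fun i j : Fin 2 => if i.val + j.val + 1 = 2 then (1 : L) else 0)).Local v := fun y => e.symm y
  have hes_mul : ∀ a b, es (a * b) = es a * es b := fun a b => map_mul e.symm a b
  have hes_inv : ∀ a, es a⁻¹ = (es a)⁻¹ := fun a => map_inv e.symm a
  have he_es : ∀ y, e (es y) = y := fun y => e.apply_symm_apply y
  have hes_e : ∀ g : (UnitaryGroup.cmDatum L 2 (Matrix.of fun i j : Fin 2 => if i.val + j.val + 1 = 2 then (1 : L) else 0)).Local v, es (e g) = g := fun g => e.symm_apply_apply g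
  have hes_c : Continuous es := e.symm.continuous
  have hmemT' : ∀ g' : ↥(unitaryGroupOfForm σ J), g' ∈ T' ↔ es g' ∈ T := fun g' => by
    have h := hTT' (es g')
    have h2 : e.toMulEquiv (es g') = g' := he_es g'
    rw [h2] at h
    exact h
  have hset : (T' : Set ↥(unitaryGroupOfForm σ J)) = e '' (T : Set ((UnitaryGroup.cmDatum L 2 (Matrix.of fun i j : Fin 2 => if i.val + j.val + 1 = 2 then (1 : L) else 0)).Local v)) := by
    ext g'
    constructor
    · intro hg'
      exact ⟨es g', (hmemT' g').1 hg', he_es g'⟩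
    · rintro ⟨g, hg, rfl⟩
      exact (hTT' g).2 hg
  have hT'cpt : IsCompact (T' : Set ↥(unitaryGroupOfForm σ J)) := by rw [hset]; exact hTcpt.image e.continuous
  -- ### transported instances on the model group and Borel structures
  haveI : T2Space ↥(unitaryGroupOfForm σ J) := e.symm.toHomeomorph.symm.t2Space
  haveI : SecondCountableTopology ↥(unitaryGroupOfForm σ J) := e.symm.toHomeomorph.secondCountableTopology
  haveI : LocallyCompactSpace ↥(unitaryGroupOfForm σ J) := e.symm.toHomeomorph.isClosedEmbedding.locallyCompactSpace
  have hT'c : IsClosed (T' : Set ↥(unitaryGroupOfForm σ J)) := hT'cpt.isClosed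
  letI : MeasurableSpace ↥(unitaryGroupOfForm σ J) := borel _
  haveI : BorelSpace ↥(unitaryGroupOfForm σ J) := ⟨rfl⟩
  letI : MeasurableSpace (↥(unitaryGroupOfForm σ J) ⧸ T') := borel _
  haveI : BorelSpace (↥(unitaryGroupOfForm σ J) ⧸ T') := ⟨rfl⟩
  -- ### the model conjugation family `Φ' = e ∘ Φ ∘ (e⁻¹ × e⁻¹)`
  let qm : ↥(unitaryGroupOfForm σ J) ⧸ T' → (UnitaryGroup.cmDatum L 2 (Matrix.of fun i j : Fin 2 => if i.val + j.val + 1 = 2 then (1 : L) else 0)).Local v ⧸ T :=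
    Quotient.map' es fun a b hab => by
      rw [QuotientGroup.leftRel_apply] at hab ⊢
      have h : es (a⁻¹ * b) ∈ T := (hmemT' _).1 hab
      rw [hes_mul, hes_inv] at h
      exact h
  have hqm : ∀ y : ↥(unitaryGroupOfForm σ J), qm (QuotientGroup.mk y) = QuotientGroup.mk (es y) := fun y => rfl
  let Φ' : (↥(unitaryGroupOfForm σ J) ⧸ T') × ↥T' → ↥(unitaryGroupOfForm σ J) :=
    fun p => e (Φ (qm p.1, ⟨es (p.2 : ↥(unitaryGroupOfForm σ J)), (hmemT' _).1 p.2.2⟩))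
  have hΦ' : ∀ (y : ↥(unitaryGroupOfForm σ J)) (t' : ↥T'), Φ' (QuotientGroup.mk y, t') = y * t' * y⁻¹ := by
    intro y t'
    show e (Φ (qm (QuotientGroup.mk y), ⟨es (t' : ↥(unitaryGroupOfForm σ J)), (hmemT' _).1 t'.2⟩)) = y * t' * y⁻¹
    rw [hqm, hΦ]
    show e (es y * es (t' : ↥(unitaryGroupOfForm σ J)) * (es y)⁻¹) = y * t' * y⁻¹
    rw [← hes_inv, ← hes_mul, ← hes_mul, he_es]
  -- ### the model weight `D' = D ∘ e⁻¹`
  let ψ : ↥T' → ↥T := fun t' => ⟨es (t' : ↥(unitaryGroupOfForm σ J)), (hmemT' _).1 t'.2⟩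
  have hψc : Continuous ψ := (hes_c.comp continuous_subtype_val).subtype_mk _
  let D' : ↥T' → ℝ≥0 := fun t' => D (ψ t')
  have hDD' : ∀ (t : ↥T) (h : e.toMulEquiv (t : (UnitaryGroup.cmDatum L 2 (Matrix.of fun i j : Fin 2 => if i.val + j.val + 1 = 2 then (1 : L) else 0)).Local v) ∈ T'), D' ⟨e.toMulEquiv (t : (UnitaryGroup.cmDatum L 2 (Matrix.of fun i j : Fin 2 => if i.val + j.val + 1 = 2 then (1 : L) else 0)).Local v), h⟩ = D t := by
    intro t h
    show D (ψ ⟨e.toMulEquiv (t : (UnitaryGroup.cmDatum L 2 (Matrix.of fun i j : Fin 2 => if i.val + j.val + 1 = 2 then (1 : L) else 0)).Local v), h⟩) = D t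
    congr 1
    apply Subtype.ext
    exact hes_e (t : (UnitaryGroup.cmDatum L 2 (Matrix.of fun i j : Fin 2 => if i.val + j.val + 1 = 2 then (1 : L) else 0)).Local v)
  -- regularity along `ψ`
  have hψreg : ∀ t' : ↥T', IsRegularElt (((t' : ↥(unitaryGroupOfForm σ J))) : GL (Fin 2) K) →
      IsRegularElt ((((ψ t' : ↥T) : (UnitaryGroup.cmDatum L 2 (Matrix.of fun i j : Fin 2 => if i.val + j.val + 1 = 2 then (1 : L) else 0)).Local v)).val : GL (Fin 2) (UnitaryGroup.LocalRing L v)) := by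
    intro t' ht'
    have h := (isRegularElt_localNonsplitEquiv_iff (IsCMField.complexConj L) 2 (Matrix.of fun i j : Fin 2 => if i.val + j.val + 1 = 2 then (1 : L) else 0) (IsCMField.complexConj_ne_one L) w hw
      (es (t' : ↥(unitaryGroupOfForm σ J)))).1
    refine h ?_
    have h2 : e.toMulEquiv (es (t' : ↥(unitaryGroupOfForm σ J))) = (t' : ↥(unitaryGroupOfForm σ J)) := he_es _
    rw [h2]
    exact ht'
  -- `D` is locally constant at the regular points of `T` (★ DGLc, the closed form), hence so is `D'` on `T'`
  have hDlcT : ∀ s₀ : ↥T, IsRegularElt (((s₀ : (UnitaryGroup.cmDatum L 2 (Matrix.of fun i j : Fin 2 => if i.val + j.val + 1 = 2 then (1 : L) else 0)).Local v)).val : GL (Fin 2) (UnitaryGroup.LocalRing L v)) → ∀ᶠ s in 𝓝 s₀, D s = D s₀ := by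
    intro s₀ hs₀
    have hs₀' : IsUnit ((((s₀ : (UnitaryGroup.cmDatum L 2 (Matrix.of fun i j : Fin 2 => if i.val + j.val + 1 = 2 then (1 : L) else 0)).Local v)).val : GL (Fin 2) (UnitaryGroup.LocalRing L v)).val.charpoly.discr) :=
      (Literature.LinearAlgebra.Matrix.isUnit_discr_iff_separable_of_monic (Matrix.charpoly_monic _)).2 ((isRegularElt_iff _).1 hs₀)
    have h := (continuous_subtype_val.tendsto s₀).eventually (F0P3cStCharTSDGLc.dgFormulaTwo_eventually_eq L v (Matrix.of fun i j : Fin 2 => if i.val + j.val + 1 = 2 then (1 : L) else 0) (s₀ : (UnitaryGroup.cmDatum L 2 (Matrix.of fun i j : Fin 2 => if i.val + j.val + 1 = 2 then (1 : L) else 0)).Local v) hs₀')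
    filter_upwards [h] with s hs
    rw [hD s, hD s₀]
    have hs' := NNReal.coe_injective hs
    exact congrArg NNReal.sqrt (NNReal.sqrt.injective (NNReal.sqrt.injective hs'))
  have hDlc : ∀ t₀ : ↥T', IsRegularElt (((t₀ : ↥(unitaryGroupOfForm σ J))) : GL (Fin 2) K) → ∀ᶠ t in 𝓝 t₀, D' t = D' t₀ := by
    intro t₀' ht₀'
    exact (hψc.tendsto t₀').eventually (hDlcT (ψ t₀') (hψreg t₀' ht₀'))
  -- ### `hDval`: file 1 ∕ 2 + §1
  have hDval : ∀ t₀ : ↥T', IsRegularElt ((t₀ : ↥(unitaryGroupOfForm σ J)) : GL (Fin 2) K) →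
      ∀ (𝔲 : AddSubgroup (Matrix (Fin 2) (Fin 2) K)) [MeasurableSpace ↥𝔲] [BorelSpace ↥𝔲] [LocallyCompactSpace ↥𝔲],
        (∀ X, X ∈ 𝔲 ↔ (X.map σ)ᵀ * J + J * X = 0) → ∀ Lm : ↥𝔲 ≃ₜ+ ↥𝔲,
          (∀ X : ↥𝔲, (X : Matrix (Fin 2) (Fin 2) K) * (((t₀ : ↥(unitaryGroupOfForm σ J)) : GL (Fin 2) K) : Matrix (Fin 2) (Fin 2) K) =
              (((t₀ : ↥(unitaryGroupOfForm σ J)) : GL (Fin 2) K) : Matrix (Fin 2) (Fin 2) K) * X → Lm X = X) →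
          (∀ (X : ↥𝔲) (Y : Matrix (Fin 2) (Fin 2) K),
              (X : Matrix (Fin 2) (Fin 2) K) = (((t₀ : ↥(unitaryGroupOfForm σ J)) : GL (Fin 2) K) : Matrix (Fin 2) (Fin 2) K) * Y *
                  ((((t₀ : ↥(unitaryGroupOfForm σ J)) : GL (Fin 2) K)⁻¹ : GL (Fin 2) K) : Matrix (Fin 2) (Fin 2) K) - Y →
              ((Lm X : ↥𝔲) : Matrix (Fin 2) (Fin 2) K) = ((((t₀ : ↥(unitaryGroupOfForm σ J)) : GL (Fin 2) K)⁻¹ : GL (Fin 2) K) : Matrix (Fin 2) (Fin 2) K) * X *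
                  (((t₀ : ↥(unitaryGroupOfForm σ J)) : GL (Fin 2) K) : Matrix (Fin 2) (Fin 2) K) - X) →
          ((D' t₀ : ℝ≥0) : ℝ≥0∞) = addEquivAddHaarChar Lm := by
    intro t₀' ht₀' 𝔲 _ _ _ h𝔲 Lm hLt hLm
    have hU : ((((t₀' : ↥(unitaryGroupOfForm σ J)) : GL (Fin 2) K) : Matrix (Fin 2) (Fin 2) K).map σ)ᵀ * J *
        (((t₀' : ↥(unitaryGroupOfForm σ J)) : GL (Fin 2) K) : Matrix (Fin 2) (Fin 2) K) = J :=
      mem_unitaryGroupOfForm_iff.1 (t₀' : ↥(unitaryGroupOfForm σ J)).2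
    have hsep : ((((t₀' : ↥(unitaryGroupOfForm σ J)) : GL (Fin 2) K) : Matrix (Fin 2) (Fin 2) K)).charpoly.Separable := (isRegularElt_iff _).1 ht₀'
    rw [F0P3cStCharTSAdRegularisedDetTwo.addEquivAddHaarChar_eq_sqrt_normAbs_fin_two σ hσc hσ2 hσne J hJ hJh _ hU hsep 𝔲 h𝔲 Lm hLt hLm]
    congr 1
    show D (ψ t₀') = _
    have hmodel : e (((ψ t₀' : ↥T) : (UnitaryGroup.cmDatum L 2 (Matrix.of fun i j : Fin 2 => if i.val + j.val + 1 = 2 then (1 : L) else 0)).Local v)) = (t₀' : ↥(unitaryGroupOfForm σ J)) := he_es _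
    rw [hD, weightFormula_eq_normAbs_model_two L v w hw ((ψ t₀' : ↥T) : (UnitaryGroup.cmDatum L 2 (Matrix.of fun i j : Fin 2 => if i.val + j.val + 1 = 2 then (1 : L) else 0)).Local v), hmodel]
  -- ### ★ Q9 generic fed with ★ C8b-model at `N = 2` (instances passed by name, as ★ Q9-CM does)
  exact @tubeJacobianLocal_local_of_forall_model _ _ _ _ _ _ _ _ (IsCMField.complexConj L) 2 (Matrix.of fun i j : Fin 2 => if i.val + j.val + 1 = 2 then (1 : L) else 0) _
    (IsCMField.complexConj_ne_one L) w hw γ₀ T hT T' hT' instM instB instLC instSC instT2 hTc instQM instQB ν instν₁ instν₂ tm instt₁ instt₂ instt₃ instt₄ Φ hΦ D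
    _ _ _ _ _ hT'c _ _ Φ' hΦ' D' hDD'
    (fun ν' _ _ tm' _ _ _ _ => tubeJacobianLocal_elliptic_model _ _ hσc hσ2 hJ hγ₀' hT' hT'cpt hT'c ν' tm' Φ' hΦ' D' hDlc hDval)

end CM

end Summit.HodgeConjecture.HodgeConjecture.Cruxes.H413.F0P3cStCharTSJacCartanWeightDockTwo

end
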